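import Literature.NumberTheory.EllipticCurves.MordellCurveThreeDescent
import Literature.NumberTheory.EllipticCurves.BSDSelmer
import HarnessLib

/-!
# The two classical inputs to Sylvester's problem for a prime `p ≡ 4, 7, 8 (mod 9)`: the `3`-descent bound `corank_{ℤ₃} Sel_{3^∞}(E_p/ℚ) ≤ 1` (Satgé 1986, Thm. 2.9) and the root number `w(E_p/ℚ) = −1` (Dasgupta–Voight 2018, display (2))

Throughout, `E_p` is the elliptic curve `x³ + y³ = p` on its Weierstrass model `y² = x³ − 432 p²`,
i.e. the tree's `mordellCurve (-(432 * p ^ 2)) = ⟨0, 0, 0, 0, −432 p²⟩` (`MordellCurveThreeDescent`: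
"Cassels' `C_d : x³ + y³ + d z³ = 0` is `E_{−432 d²}`"). Both sources use exactly this model:
Satgé 1986, p. 295: "la courbe `X³ + Y³ = DZ³`, c'est-à-dire la courbe `Y²Z = X³ − 2⁴3³D²Z³`";
Dasgupta–Voight 2018, §1.1: "The equation for `E_n` can be transformed via a change of variables
to yield the Weierstrass equation `y² = x³ − 432n²`." The model is minimal at every prime (Satgé
1986, Lemme 0.1: `Y²Z = X³ + mZ³` is a minimal equation over `ℚ_ℓ` for every prime `ℓ` when `m`
is sixth-power free; here `m = −2⁴·3³·p²`).

These two facts, together with the `3`-parity theorem already in the tree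
(`Literature.NumberTheory.EllipticCurves.p_parity`, Dokchitser–Dokchitser 2010), give
`corank_{ℤ₃} Sel_{3^∞}(E_p/ℚ) = 1` for every prime `p ≡ 4, 7, 8 (mod 9)` — the Selmer-side input
of every known or claimed approach to Sylvester's problem (Dasgupta–Voight 2018 §1.1–1.2; Kříž,
arXiv:2002.04767v5, proof of Thm. 10.14; Fan–Wan, arXiv:2304.09806v2, proof of Thm. 1.2: "By
[Satgé, Theorem 2.9], the `3`-adic Selmer rank of `E_p` is less than or equal to `2`. By the parity
result [DD, Theorem 1.9], the `3`-adic Selmer rank is odd. Thus it must be `1`."). The consumer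
(Sylvester's statement modulo a rank-one `3`-converse) is
`Kriz2020/SylvesterProofs.lean`.

## Citation header (read by this seat from the held texts named)

* P. Satgé, *Groupes de Selmer et corps cubiques*, J. Number Theory **23** (1986), no. 3,
  294–317, doi:10.1016/0022-314X(86)90075-2. PUBLISHED (refereed journal). Held: lit store
  `paper:doi-10-1016-0022-314x-86-90075-2` (24 pp., OCR). Notation (§2, "le cas de Selmer"):
  `D = 3^s l₁^{λ₁}⋯l_a^{λ_a} r₁^{ρ₁}⋯r_c^{ρ_c}` cube-free, `l_i ≡ 1 (mod 3)`, `r_j ≡ −1 (mod 3)`;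
  `A : Y²Z = X³ − 2⁴3³D²Z³`, `λ : A → A'` the rational `3`-isogeny, `S` and `S'` the Selmer groups
  over `ℚ` of `λ` and of its dual. **Théorème 2.9** (p. 312), under the hypothesis (H) — vacuous
  when `D` has a single prime factor `≠ 3` — computes `S` and `S'` as explicit `𝔽₃`-vector spaces
  in terms of `a`, `c`, `s` and congruences mod `9`; for `D = p` prime: `p ≡ 4, 7 (mod 9)` (case
  (2): `s = 0`, `D ≢ ±1 (mod 9)`, `a = 1`, `c = 0`) gives `S ≅ S' ≅ ℤ/3ℤ`; `p ≡ 8 (mod 9)` (case (1):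
  `s = 0`, `D ≡ −1 (mod 9)`, `a = 0`, `c = 1`, `r₁ ≡ −1 (mod 9)`) gives `S ≅ S' ≅ ℤ/3ℤ`; and
  `p ≡ 2, 5 (mod 9)` gives `S ≅ ℤ/3ℤ`, `S' = 0`, "le rang sur `ℚ` de la courbe `A` est nul" (p. 313,
  the Pépin–Lucas–Sylvester–Selmer theorems; in the tree, elementarily, as
  `Literature.NumberTheory.DiophantineGeometry.not_exists_rat_cube_add_cube_eq_prime`). With
  `A(ℚ)[3] = 0` (`p ≥ 3`: Dasgupta–Voight 2018 §1.1, "`E_n(ℚ)_tors = {∞}` for `n ≥ 3`") and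
  `A'(ℚ)[λ̂] ≅ ℤ/3ℤ` the descent exact sequence
  `0 → A'(ℚ)[λ̂]/λ(A(ℚ)[3]) → S → Sel₃(A/ℚ) → S'` gives `dim_{𝔽₃} Sel₃(E_p/ℚ) ≤ 1`, hence
  `corank_{ℤ₃} Sel_{3^∞}(E_p/ℚ) ≤ dim_{𝔽₃} Sel₃(E_p/ℚ) − dim_{𝔽₃} E_p(ℚ)[3] ≤ 1`, for
  `p ≡ 4, 7, 8 (mod 9)`. This is the reading of Thm. 2.9 printed as display (1) of Dasgupta–Voight
  2018 ("An explicit `3`-descent [Satgé] shows that `rank E_p(ℚ) ≤ 1` if `p ≡ 4, 7, 8 (mod 9)`")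
  and as "`r_3(E_d) ≤ 1` for `d ≡ 4, 7, 8 (mod 9)`, by standard `3`-descent [DasguptaVoight],
  [Satge]" in Kříž v5 (proof of Thm. 10.14, SP_v5.tex l. 10971); Fan–Wan v2 record the cruder
  `≤ 2` (= `dim S + dim S'`), which with parity gives the same conclusion.
* S. Dasgupta and J. Voight, *Sylvester's problem and mock Heegner points*, Proc. Amer. Math.
  Soc. **146** (2018), no. 8, 3257–3273, doi:10.1090/proc/14008 (arXiv:1707.05874). PUBLISHED.
  Held: lit store `paper:arxiv-1707.05874`. §1.1, display (2), verbatim: "At the same time, the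
  sign of the functional equation for the `L`-series of `E_p` is
  `ε(L(E_p/ℚ, s)) = −1` if `p ≡ 4, 7, 8 (mod 9)`; `+1` otherwise." (The computation goes back to
  Birch–Stephens, *The parity of the rank of the Mordell–Weil group*, Topology 5 (1966), and is a
  case of Liverance, J. Number Theory 51 (1995) 288–305; the same display is (1.2) of Hu–Shu–Yin,
  arXiv:1708.05266, and the sign table of Yin, arXiv:1912.13338, p. 1.) Also used from this
  source: Conjecture 1 (Sylvester [Sylvester], Selmer [Selmer]): "If `p ≡ 4, 7, 8 (mod 9)`, then
  `rank E_p(ℚ) > 0`"; Theorem 2 (unconditional): `p ≡ 4, 7 (mod 9)` prime with `3` not a cube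
  modulo `p` ⟹ `rank E_p(ℚ) = rank E_{p²}(ℚ) = 1`; and "We are not aware of any results
  concerning the case `p ≡ 8 (mod 9)`".

## What is here

Two named facts (`def … : Prop`, D-0014; nothing is asserted):

* `satge_selmerCorank_three_le_one_of_prime_mod_nine` — `corank_{ℤ₃} Sel_{3^∞}(E_p/ℚ) ≤ 1` for
  every prime `p ≡ 4, 7, 8 (mod 9)`;
* `rootNumber_cubeSumCurve_prime_eq_neg_one_of_mod_nine` — `w(E_p/ℚ) = −1` for every prime
  `p ≡ 4, 7, 8 (mod 9)`.
* (added 2026-08-26, cell `bsd-cn100` seat `s2b-c3`) `satge_selmerCorank_three_le_one_cubeSum_sq_of_prime_mod_nine`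
  — the SAME instance of Satgé's Thm. 2.9 for the square `D = p²`, `p ≡ 4, 7 (mod 9)`:
  `corank_{ℤ₃} Sel_{3^∞}(E_{p²}/ℚ) ≤ 1` on the model `y² = x³ − 432 (p²)²` of `x³ + y³ = p²`. Thm. 2.9
  depends on the cube-free `D = 3^s ∏ l_i^{λ_i} ∏ r_j^{ρ_j}` only through `s`, `a`, `c`, `D mod 9` and
  (H) — not through the exponents (cf. p. 313: "`D = r^v … v = 1, 2`") — and `D = p²` with
  `p ≡ 4, 7 (mod 9)` has `s = 0`, `a = 1`, `c = 0`, `D ≡ 7, 4 (mod 9) ≢ ±1`, (H) vacuous: case (2)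
  again, `S ≅ S' ≅ ℤ/3ℤ`, and the same descent exact sequence (`E_{p²}(ℚ)_tors = {∞}` since
  `p² ≥ 3` is cube-free, Dasgupta–Voight 2018 §1.1; `A'(ℚ)[λ̂] ≅ ℤ/3ℤ`, Remarque 2.7) gives
  `dim_{𝔽₃} Sel₃(E_{p²}/ℚ) ≤ 1`. Consumer: the non-vacuity of the Dasgupta–Voight square-family rung
  of `Summits/BirchSwinnertonDyer/BirchSwinnertonDyer/Theorems/MordellShaFreeCutRungDVSquare.lean`
  (with Dasgupta–Voight 2018 Thm. 2, `rank E_{p²}(ℚ) = 1`, tree fact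
  `DasguptaVoight2018.thm2_mordellWeilRank_eq_one_cubeSum_prime_and_sq`, it yields
  `corank_{ℤ₃} Sel_{3^∞}(E_{p²}) = 1`). The class `p ≡ 8 (mod 9)` (`D = p² ≡ 1 (mod 9)`, case (1) of
  Thm. 2.9) is deliberately NOT included: its sub-case condition is not legible in the held OCR.

## Carrier notes

* `WeierstrassCurve.selmerCorank W p` is the tree's carrier of `corank_{ℤ_p} Sel_{p^∞}(E/ℚ)`
  (`Selmer.lean`), the quantity in `p_parity` and in `smith_selmerCorank_density`; the fact is
  stated for the displayed (everywhere minimal) model, as both sources do.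
* `WeierstrassCurve.rootNumber W` is the ANALYTIC root number (the sign of the functional
  equation of the completed `L`-function, `RootNumber.lean`) — exactly Dasgupta–Voight's
  "sign of the functional equation for the `L`-series of `E_p`".
* Why the Selmer bound is not proved here: the tree's `3`-descent files for Mordell curves
  (`MordellCurveThreeDescent*`, `MordellCurvePhiDescentHom`, `MordellCurveCubicDescentLocal`) vendor
  the local descent maps and images, not a global `λ`-Selmer group joined to `selmerCorank`; the
  dictionary `#S · #S' ⟹ corank` is therefore part of the cited statement, as in the three modern
  sources quoted above.
-/

open WeierstrassCurve

namespace Literature.NumberTheory.EllipticCurves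

/-- **The `3`-descent bound for `x³ + y³ = p`, `p ≡ 4, 7, 8 (mod 9)` prime (Satgé 1986, Thm. 2.9,
read through the descent exact sequence; = display (1) of Dasgupta–Voight 2018 on the Selmer
side).** For every prime `p ≡ 4, 7, 8 (mod 9)`, `corank_{ℤ₃} Sel_{3^∞}(E_p/ℚ) ≤ 1`, where
`E_p : y² = x³ − 432 p²` is the Weierstrass model of `x³ + y³ = p`. (Thm. 2.9: the Selmer groups of
the `3`-isogeny `λ : E_p → E'_p` and of its dual are both `ℤ/3ℤ` for such `p` — case (2) with
`a = 1, c = 0` for `p ≡ 4, 7`, case (1) with `a = 0, c = 1` for `p ≡ 8 (mod 9)` — whence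
`dim_{𝔽₃} Sel₃(E_p/ℚ) ≤ 1 + 1 − dim E'_p(ℚ)[λ̂] = 1` and the corank bound.)
[cite: Satge1986, Thm. 2.9 (p. 312), cases (1)–(2) for D = p prime]
[cite: DasguptaVoight2018, §1.1 display (1)] -/
def satge_selmerCorank_three_le_one_of_prime_mod_nine : Prop :=
  ∀ ⦃p : ℕ⦄, p.Prime → (p % 9 = 4 ∨ p % 9 = 7 ∨ p % 9 = 8) →
    (mordellCurve (-(432 * (p : ℚ) ^ 2))).selmerCorank 3 ≤ 1

/-- **The root number of `x³ + y³ = p`, `p ≡ 4, 7, 8 (mod 9)` prime, is `−1` (Dasgupta–Voight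
2018, §1.1 display (2); Birch–Stephens 1966).** "The sign of the functional equation for the
`L`-series of `E_p` is `−1` if `p ≡ 4, 7, 8 (mod 9)`; `+1` otherwise" — the first clause, on the
Weierstrass model `E_p : y² = x³ − 432 p²`, with the tree's analytic root number
`WeierstrassCurve.rootNumber` (the sign of the functional equation of the completed `L`-function).
[cite: DasguptaVoight2018, §1.1 display (2)] -/
def rootNumber_cubeSumCurve_prime_eq_neg_one_of_mod_nine : Prop :=
  ∀ ⦃p : ℕ⦄, p.Prime → (p % 9 = 4 ∨ p % 9 = 7 ∨ p % 9 = 8) →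
    (mordellCurve (-(432 * (p : ℚ) ^ 2))).rootNumber = -1

/-- **The `3`-descent bound for `x³ + y³ = p²`, `p ≡ 4, 7 (mod 9)` prime (Satgé 1986, Thm. 2.9
case (2), read through the descent exact sequence exactly as for `D = p`).** For every prime
`p ≡ 4, 7 (mod 9)`, `corank_{ℤ₃} Sel_{3^∞}(E_{p²}/ℚ) ≤ 1`, where `E_{p²} : y² = x³ − 432 (p²)²` is the
Weierstrass model of `x³ + y³ = p²` (Dasgupta–Voight 2018 §1.1, `n = p²`). Reading: the cube-free
`D = p²` has `s = 0`, one prime factor `l₁ = p ≡ 1 (mod 3)` (`a = 1`, `λ₁ = 2`), `c = 0`, and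
`D ≡ 7, 4 (mod 9) ≢ ±1`; hypothesis (H) is vacuous for a single prime factor; Thm. 2.9 (2)
("Si `s = 0` et `D ≢ ±1 mod 9`") gives the Selmer groups `S ≅ S' ≅ ℤ/3ℤ` of the `3`-isogeny
`λ : A → A'` and its dual — the statement sees `D` only through `(s, a, c, D mod 9)`, the exponent
`λ₁ = 2` playing no role (p. 313 treats `D = r^v`, `v = 1, 2` alike) — whence, with
`A(ℚ)[3] = 0` (`E_n(ℚ)_tors = {∞}` for cube-free `n ≥ 3`) and `A'(ℚ)[λ̂] ≅ ℤ/3ℤ` (Remarque 2.7),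
`dim_{𝔽₃} Sel₃(E_{p²}/ℚ) ≤ 1` and the corank bound, verbatim the derivation recorded for
`satge_selmerCorank_three_le_one_of_prime_mod_nine`. The class `8 (mod 9)` is not included (case (1)
of Thm. 2.9; sub-case condition not legible in the held OCR).
[cite: Satge1986, Thm. 2.9 (p. 312), case (2) with a = 1, c = 0, s = 0 for D = p² ; p. 313 (exponents v = 1, 2)]
[cite: DasguptaVoight2018, §1.1 (model y² = x³ − 432n², torsion of E_n)] -/
def satge_selmerCorank_three_le_one_cubeSum_sq_of_prime_mod_nine : Prop :=
  ∀ ⦃p : ℕ⦄, p.Prime → (p % 9 = 4 ∨ p % 9 = 7) →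
    (mordellCurve (-(432 * ((p : ℚ) ^ 2) ^ 2))).selmerCorank 3 ≤ 1

end Literature.NumberTheory.EllipticCurves
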